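import Summits.QuantumFields.YangMills.Theorems.UnitScaleTiltHistoryTailOfPinnedHeightTail

/-!
# Crux `HistoryTailL` (stmt-QuantumFields-19936) — FILE K-20: THE WEAKEST LETTER ON THE BOOKS «WEAK HEIGHT TAIL», AND THE DOORS INTO IT
# (answers ★★OWNER WORD 47 (ii) «ONE letter; the other two by one-line doors»; LEAD seat ym-ust-19936-w1 g11)

Cell `ym3-torus` (YM ladder rung R3 = continuum SU(2) Yang–Mills on T³ — a RUNG, NOT the Clay problem: not d = 4, not infinite volume, not a
mass gap).  Helper `--supports stmt-QuantumFields-19936`; THEOREMS ONLY, def-free.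

THE THREE CANDIDATE LETTERS for the deep-heights organ of 19936 and how they compare, binder by binder:
* `EntropyFloor.stub_geometricTail` (line «entropy-floor», g4; door ✓`EntropyFloorHistoryTailOfGeometric.historyTailL_of_geometricTail`):
  profile CHOSEN per floors (`∀ L b₁ p₁, ∃ b₀ p₀ ⪰ …`) ✓weak · `γ₁` BEFORE `m` (one threshold for all `m`) ✗ · constants `D, ρ` after `F, γ` ✓ ·
  rate `D·ρ^{K−j}` with ANY `ρ·L³ < 1` ✓weak · ALL heights `1 ≤ j ≤ K` ✗ · NO finer-small conditioner ✗;
* K-19 ✓`UnitScaleTiltHistoryTailOfPinnedHeightTail.historyTailL_of_geometricHeightTail`'s `hG`: floors THEN every profile above them ✗ · `γ₁` after `m` ✓ ·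
  `Cv` after `F, γ` ✓ · rate `Cv·(L⁻⁴)^{K−j}` (fixed ratio) ✗ · constrained heights only (`j + 2 ≤ K`, `j + ⌊(K−1)∕m⌋ ≤ K`) ✓ · conditioner ✓;
* K-19 `historyTailL_of_pinnedHeightTail`'s `hP`: as `hG` with Bałaban's (70)∕(71) shape `C·β^A·e^{−cp²}`.
This file states the letter that is WEAKEST IN EVERY COLUMN — profile chosen per floors, `γ₁` after `m`, `(Cv, ρ)` after `F, γ`, any ratio
`ρ·L³ < 1`, constrained heights only, conditioner present — proves that it still gives the crux BY NAME (`historyTailL_of_weakHeightTail`), and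
types the two DOORS: `weakHeightTail_of_geometricTail` (EntropyFloor's letter ⇒ the weak letter, pure monotonicity) and
`weakHeightTail_of_geometricHeightTail` (K-19's `hG` ⇒ the weak letter, `ρ := L⁻⁴`).  So whichever letter the planner registers, the other
displays follow by one `exact`; and a supplier (LINE «PinnedStability» ∕ PlanPinned41's `stub_pinnedRatio` lane) may aim at the weak letter.
HONEST: glue only; none of the three letters is proved (each is the d = 3 large-field step for expectations, pinned, as a Gibbs probability);
`HistoryTailL` is NOT proved; YM₃ on T³ is rung R3, not Clay; the Yang–Mills mass gap is NOT proved.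
References: T. Bałaban, CMP 102 (1985) 255–275 [Balaban1985UV3] ((7) p.257, (41) p.266, (70)–(71) p.273).
-/

set_option autoImplicit false

noncomputable section

open MeasureTheory Filter Topology
open Literature.MathematicalPhysics.QuantumFieldTheory.Balaban1983to89
open Literature.MathematicalPhysics.QuantumFieldTheory.Balaban1983to89.Missing
open Literature.MathematicalPhysics.QuantumFieldTheory.Balaban1983to89.T4Continuum
open Literature.MathematicalPhysics.QuantumFieldTheory.Balaban1983to89.T3ContinuumYM3Torus
open Literature.MathematicalPhysics.QuantumFieldTheory.Balaban1983to89.T3UnitScaleTilt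
open Literature.MathematicalPhysics.QuantumFieldTheory.Balaban1983to89.T3UnitLawDensityEML (ℰp measurableE_ℰp)
open Literature.MathematicalPhysics.QuantumFieldTheory.Balaban1983to89.T3BareTailProfile
open Summit.QuantumFields.YangMills.Theorems.HistoryTailOfTwoSided
open Summit.QuantumFields.YangMills.Theorems.PoincareLipschitzHistoryTailOfLinearTail (real_not_plaqSmall_inter_le_sum)
open Summit.QuantumFields.YangMills.Theorems.PoincareLipschitzHistoryTailOfLinearTailDeep (historyTailAt_of_bare_finestBad_deep)

namespace Summit.QuantumFields.YangMills.Theorems.UnitScaleTiltHistoryTailOfWeakHeightTail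

/-! ## §1 Geometric profiles of arbitrary ratio -/

/-- A geometric profile `q(i) = A·r^i` with `A ≥ 0`, `0 ≤ r < 1` is non-negative, summable, and has summable tail sums
(`Σ'_t q(t+n) = A(1−r)⁻¹·r^n`).  [folklore] -/
theorem geometric_profile_ratio {A r : ℝ} (hA : 0 ≤ A) (hr0 : 0 ≤ r) (hr1 : r < 1) :
    (∀ i : ℕ, 0 ≤ A * r ^ i) ∧ Summable (fun i : ℕ => A * r ^ i) ∧
      Summable (fun n : ℕ => ∑' t : ℕ, A * r ^ (t + n)) := by
  refine ⟨fun i => by positivity, (summable_geometric_of_lt_one hr0 hr1).mul_left A, ?_⟩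
  have heq : (fun n : ℕ => ∑' t : ℕ, A * r ^ (t + n)) = fun n => (A * (1 - r)⁻¹) * r ^ n := by
    funext n
    have h1 : (fun t : ℕ => A * r ^ (t + n)) = fun t => (A * r ^ n) * r ^ t := by
      funext t; rw [pow_add]; ring
    rw [h1, tsum_mul_left, tsum_geometric_of_lt_one hr0 hr1]; ring
  rw [heq]
  exact (summable_geometric_of_lt_one hr0 hr1).mul_left _

/-! ## §2 The weak letter gives the crux -/

/-- ★★★ **`UnitScaleTilt.HistoryTailL` FROM THE WEAK HEIGHT TAIL** — the weakest letter on the books: `∀ L b₁ p₁, ∃ (b₀,p₀) ⪰ (b₁,p₁)` (profile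
CHOSEN), `∀ m > 0, ∃ γ₁ ∈ (0,1]` (threshold AFTER `m`), `∀ F γ, ∃ Cv ≥ 0, ρ ≥ 0, ρ·L³ < 1` (constants and ratio AFTER the family), and the bound
`Gibbs_K({θ(K−j) ≤ dist1 Ū^{j}(∂a)} ∩ {∀ i < j, PlaqSmall θ(K−i) Ū^{i}}) ≤ Cv·ρ^{K−j}` ONLY at heights `1 ≤ j`, `j + 2 ≤ K`, `j + ⌊(K−1)∕m⌋ ≤ K`.  Per
height the mass is `≤ 9·8L^{3m}(L^{K−j})³·Cv·ρ^{K−j} = 72·Cv·L^{3m}·(ρL³)^{K−j}` (✓`card_plaq_le_pow`), a geometric profile of ratio `ρL³ < 1`;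
bare term ✓`bareTailAt`; reduction K-18b ✓`historyTailAt_of_bare_finestBad_deep`.  [cite: Balaban1985UV3, (7) p.257 and (70)-(71) p.273] -/
theorem historyTailL_of_weakHeightTail
    (hW : ∀ (L : ℕ) (b₁ p₁ : ℝ), ∃ (b₀ p₀ : ℝ), b₁ ≤ b₀ ∧ p₁ ≤ p₀ ∧ 0 < b₀ ∧ 2 < p₀ ∧ ∀ (m : ℕ), 0 < m →
      ∃ γ₁ : ℝ, 0 < γ₁ ∧ γ₁ ≤ 1 ∧ ∀ (F : T3Family) (γ : ℝ), F.L = L → 0 < γ → γ ≤ γ₁ →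
        ∃ (Cv ρ : ℝ), 0 ≤ Cv ∧ 0 ≤ ρ ∧ ρ * (L : ℝ) ^ 3 < 1 ∧
          ∀ (K j : ℕ), 1 ≤ j → j + 2 ≤ K → j + (K - 1) / m ≤ K → ∀ a : Plaq (F.P K) j,
          (gibbsK F ℰp γ K).real
              ({U : GaugeField (F.P K) 0 (Matrix.specialUnitaryGroup (Fin 2) ℂ) |
                  θBal F.L γ b₀ p₀ (K - j) ≤ GaugeGroup.dist1 (GaugeField.plaqHol
                    (Averaging.iter (fun i' => BlockAveraging.blockAvg (P := F.P K) (j := i') ℰp) j U) a)} ∩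
                {U : GaugeField (F.P K) 0 (Matrix.specialUnitaryGroup (Fin 2) ℂ) | ∀ i, i < j →
                  PlaqSmall (θBal F.L γ b₀ p₀ (K - i))
                    (Averaging.iter (fun i' => BlockAveraging.blockAvg (P := F.P K) (j := i') ℰp) i U)}) ≤
            Cv * ρ ^ (K - j)) :
    Summit.QuantumFields.YangMills.Theses.UnitScaleTilt.HistoryTailL := by
  intro L b₁ p₁
  obtain ⟨b₀, p₀, hb₁, hp₁, hb₀, hp₀, H⟩ := hW L b₁ p₁
  have hp₀1 : 1 ≤ p₀ := by linarith
  refine ⟨b₀, p₀, hb₁, hp₁, hb₀, hp₀, fun m hm => ?_⟩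
  obtain ⟨γ₁, hγ₁, hγ₁1, HF⟩ := H m hm
  refine ⟨γ₁, hγ₁, fun F γ hFL hγ hγle => ?_⟩
  have hγ1 : γ ≤ 1 := hγle.trans hγ₁1
  obtain ⟨Cv, ρ, hCv, hρ, hρL, hb⟩ := HF F γ hFL hγ hγle
  obtain ⟨q₀, hq₀0, hq₀, -, hbare⟩ := bareTailAt F hγ hγ1 hb₀ hp₀1
  -- the geometric per-height profile of ratio `ρ·L³ < 1`
  have hL0 : (0 : ℝ) < F.L := by exact_mod_cast (lt_trans Nat.zero_lt_one F.hL.2)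
  set r : ℝ := ρ * (F.L : ℝ) ^ 3 with hr
  have hr0 : 0 ≤ r := by positivity
  have hr1 : r < 1 := by rw [hr, hFL]; exact hρL
  set A' : ℝ := 72 * Cv * (F.L : ℝ) ^ (3 * F.m) with hA'
  have hA'0 : 0 ≤ A' := by positivity
  obtain ⟨hq0, hq, hqt⟩ := geometric_profile_ratio hA'0 hr0 hr1
  refine historyTailAt_of_bare_finestBad_deep F hγ.le b₀ p₀ hm q₀ (fun i => A' * r ^ i)
    hq₀0 hq₀ hq0 hq hqt hbare fun K j hj1 hjK hjm => ?_
  haveI := isProbabilityMeasure_gibbsK F ℰp hγ.le K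
  refine (real_not_plaqSmall_inter_le_sum (gibbsK F ℰp γ K)
    (Averaging.iter (fun i' => BlockAveraging.blockAvg (P := F.P K) (j := i') ℰp) j) (θBal F.L γ b₀ p₀ (K - j))
    {U | ∀ i, i < j → PlaqSmall (θBal F.L γ b₀ p₀ (K - i))
      (Averaging.iter (fun i' => BlockAveraging.blockAvg (P := F.P K) (j := i') ℰp) i U)}).trans ?_
  refine (Finset.sum_le_sum fun a _ => hb K j hj1 hjK hjm a).trans ?_
  rw [Finset.sum_const, Finset.card_univ, nsmul_eq_mul]
  have hcard := card_plaq_le_pow F (show j ≤ K by omega)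
  have hX : 0 ≤ Cv * ρ ^ (K - j) := by positivity
  have hpow : ((F.L : ℝ) ^ (K - j)) ^ 3 * ρ ^ (K - j) = r ^ (K - j) := by
    rw [hr, mul_pow, ← pow_mul, ← pow_mul, mul_comm]
    congr 1
    rw [mul_comm]
  calc (Fintype.card (Plaq (F.P K) j) : ℝ) * (Cv * ρ ^ (K - j))
      ≤ (9 * (8 * (F.L : ℝ) ^ (3 * F.m) * ((F.L : ℝ) ^ (K - j)) ^ 3)) * (Cv * ρ ^ (K - j)) :=
        mul_le_mul_of_nonneg_right hcard hX
    _ = A' * (((F.L : ℝ) ^ (K - j)) ^ 3 * ρ ^ (K - j)) := by rw [hA']; ring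
    _ = A' * r ^ (K - j) := by rw [hpow]

/-! ## §3 The doors: the two letters already on the books imply the weak letter -/

/-- **DOOR 1: EntropyFloor's `stub_geometricTail` letter ⇒ the weak letter** (drop the extra heights, intersect the event, keep the threshold for
every `m`).  [cite: Balaban1985UV3, (71) p.273] -/
theorem weakHeightTail_of_geometricTail
    (hG : ∀ (L : ℕ) (b₁ p₁ : ℝ), ∃ (b₀ p₀ : ℝ), b₁ ≤ b₀ ∧ p₁ ≤ p₀ ∧ 0 < b₀ ∧ 2 < p₀ ∧ ∃ γ₁ : ℝ, 0 < γ₁ ∧ γ₁ ≤ 1 ∧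
      ∀ (F : T3Family) (γ : ℝ), F.L = L → 0 < γ → γ ≤ γ₁ → ∃ (D ρ : ℝ), 0 ≤ D ∧ 0 ≤ ρ ∧ ρ * (L : ℝ) ^ 3 < 1 ∧
        ∀ (K j : ℕ), 1 ≤ j → j ≤ K → ∀ (p : Plaq (F.P K) j),
          (gibbsK F ℰp γ K).real {U | θBal F.L γ b₀ p₀ (K - j) ≤
              GaugeGroup.dist1 (GaugeField.plaqHol (Averaging.iter (fun i => BlockAveraging.blockAvg (P := F.P K) (j := i) ℰp) j U) p)}
            ≤ D * ρ ^ (K - j)) :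
    ∀ (L : ℕ) (b₁ p₁ : ℝ), ∃ (b₀ p₀ : ℝ), b₁ ≤ b₀ ∧ p₁ ≤ p₀ ∧ 0 < b₀ ∧ 2 < p₀ ∧ ∀ (m : ℕ), 0 < m →
      ∃ γ₁ : ℝ, 0 < γ₁ ∧ γ₁ ≤ 1 ∧ ∀ (F : T3Family) (γ : ℝ), F.L = L → 0 < γ → γ ≤ γ₁ →
        ∃ (Cv ρ : ℝ), 0 ≤ Cv ∧ 0 ≤ ρ ∧ ρ * (L : ℝ) ^ 3 < 1 ∧
          ∀ (K j : ℕ), 1 ≤ j → j + 2 ≤ K → j + (K - 1) / m ≤ K → ∀ a : Plaq (F.P K) j,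
          (gibbsK F ℰp γ K).real
              ({U : GaugeField (F.P K) 0 (Matrix.specialUnitaryGroup (Fin 2) ℂ) |
                  θBal F.L γ b₀ p₀ (K - j) ≤ GaugeGroup.dist1 (GaugeField.plaqHol
                    (Averaging.iter (fun i' => BlockAveraging.blockAvg (P := F.P K) (j := i') ℰp) j U) a)} ∩
                {U : GaugeField (F.P K) 0 (Matrix.specialUnitaryGroup (Fin 2) ℂ) | ∀ i, i < j →
                  PlaqSmall (θBal F.L γ b₀ p₀ (K - i))
                    (Averaging.iter (fun i' => BlockAveraging.blockAvg (P := F.P K) (j := i') ℰp) i U)}) ≤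
            Cv * ρ ^ (K - j) := by
  intro L b₁ p₁
  obtain ⟨b₀, p₀, hb₁, hp₁, hb₀, hp₀, γ₁, hγ₁, hγ₁1, HF⟩ := hG L b₁ p₁
  refine ⟨b₀, p₀, hb₁, hp₁, hb₀, hp₀, fun m _ => ⟨γ₁, hγ₁, hγ₁1, fun F γ hFL hγ hγle => ?_⟩⟩
  obtain ⟨D, ρ, hD, hρ, hρL, hb⟩ := HF F γ hFL hγ hγle
  refine ⟨D, ρ, hD, hρ, hρL, fun K j hj1 hjK _ a => ?_⟩
  haveI := isProbabilityMeasure_gibbsK F ℰp hγ.le K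
  exact (measureReal_mono Set.inter_subset_left (measure_ne_top _ _)).trans (hb K j hj1 (by omega) a)

/-- **DOOR 2: K-19's `hG` letter (floors, then every profile; fixed ratio `L⁻⁴`) ⇒ the weak letter** (choose the profile at the floors;
`ρ := L⁻⁴`, `ρ·L³ = L⁻¹ < 1` because every family has `L ≥ 2`).  [cite: Balaban1985UV3, (71) p.273] -/
theorem weakHeightTail_of_geometricHeightTail
    (hG : ∀ (L : ℕ), ∃ (b₁' p₁' : ℝ), ∀ (b₀ p₀ : ℝ), b₁' ≤ b₀ → p₁' ≤ p₀ → 0 < b₀ → 2 < p₀ → ∀ (m : ℕ), 0 < m →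
      ∃ γ₁ : ℝ, 0 < γ₁ ∧ γ₁ ≤ 1 ∧ ∀ (F : T3Family) (γ : ℝ), F.L = L → 0 < γ → γ ≤ γ₁ →
        ∃ Cv : ℝ, 0 ≤ Cv ∧ ∀ (K j : ℕ), 1 ≤ j → j + 2 ≤ K → j + (K - 1) / m ≤ K → ∀ a : Plaq (F.P K) j,
          (gibbsK F ℰp γ K).real
              ({U : GaugeField (F.P K) 0 (Matrix.specialUnitaryGroup (Fin 2) ℂ) |
                  θBal F.L γ b₀ p₀ (K - j) ≤ GaugeGroup.dist1 (GaugeField.plaqHol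
                    (Averaging.iter (fun i' => BlockAveraging.blockAvg (P := F.P K) (j := i') ℰp) j U) a)} ∩
                {U : GaugeField (F.P K) 0 (Matrix.specialUnitaryGroup (Fin 2) ℂ) | ∀ i, i < j →
                  PlaqSmall (θBal F.L γ b₀ p₀ (K - i))
                    (Averaging.iter (fun i' => BlockAveraging.blockAvg (P := F.P K) (j := i') ℰp) i U)}) ≤
            Cv * (((F.L : ℝ)⁻¹) ^ 4) ^ (K - j)) :
    ∀ (L : ℕ) (b₁ p₁ : ℝ), ∃ (b₀ p₀ : ℝ), b₁ ≤ b₀ ∧ p₁ ≤ p₀ ∧ 0 < b₀ ∧ 2 < p₀ ∧ ∀ (m : ℕ), 0 < m →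
      ∃ γ₁ : ℝ, 0 < γ₁ ∧ γ₁ ≤ 1 ∧ ∀ (F : T3Family) (γ : ℝ), F.L = L → 0 < γ → γ ≤ γ₁ →
        ∃ (Cv ρ : ℝ), 0 ≤ Cv ∧ 0 ≤ ρ ∧ ρ * (L : ℝ) ^ 3 < 1 ∧
          ∀ (K j : ℕ), 1 ≤ j → j + 2 ≤ K → j + (K - 1) / m ≤ K → ∀ a : Plaq (F.P K) j,
          (gibbsK F ℰp γ K).real
              ({U : GaugeField (F.P K) 0 (Matrix.specialUnitaryGroup (Fin 2) ℂ) |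
                  θBal F.L γ b₀ p₀ (K - j) ≤ GaugeGroup.dist1 (GaugeField.plaqHol
                    (Averaging.iter (fun i' => BlockAveraging.blockAvg (P := F.P K) (j := i') ℰp) j U) a)} ∩
                {U : GaugeField (F.P K) 0 (Matrix.specialUnitaryGroup (Fin 2) ℂ) | ∀ i, i < j →
                  PlaqSmall (θBal F.L γ b₀ p₀ (K - i))
                    (Averaging.iter (fun i' => BlockAveraging.blockAvg (P := F.P K) (j := i') ℰp) i U)}) ≤
            Cv * ρ ^ (K - j) := by
  intro L b₁ p₁
  obtain ⟨b₁', p₁', H⟩ := hG L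
  obtain ⟨b₀, hb₁, hb₁'', hb₀1⟩ : ∃ b₀ : ℝ, b₁ ≤ b₀ ∧ b₁' ≤ b₀ ∧ 1 ≤ b₀ :=
    ⟨max b₁ (max b₁' 1), le_max_left _ _, le_max_of_le_right (le_max_left _ _), le_max_of_le_right (le_max_right _ _)⟩
  obtain ⟨p₀, hp₁, hp₁'', hp₀⟩ : ∃ p₀ : ℝ, p₁ ≤ p₀ ∧ p₁' ≤ p₀ ∧ 2 < p₀ :=
    ⟨max p₁ (max p₁' 3), le_max_left _ _, le_max_of_le_right (le_max_left _ _),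
      lt_of_lt_of_le (by norm_num) (le_max_of_le_right (le_max_right _ _))⟩
  have hb₀ : 0 < b₀ := one_pos.trans_le hb₀1
  refine ⟨b₀, p₀, hb₁, hp₁, hb₀, hp₀, fun m hm => ?_⟩
  obtain ⟨γ₁, hγ₁, hγ₁1, HF⟩ := H b₀ p₀ hb₁'' hp₁'' hb₀ hp₀ m hm
  refine ⟨γ₁, hγ₁, hγ₁1, fun F γ hFL hγ hγle => ?_⟩
  obtain ⟨Cv, hCv, hb⟩ := HF F γ hFL hγ hγle
  have hL2 : (2 : ℝ) ≤ F.L := by exact_mod_cast F.hL.2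
  have hL0 : (0 : ℝ) < F.L := by linarith
  refine ⟨Cv, ((F.L : ℝ)⁻¹) ^ 4, hCv, by positivity, ?_, fun K j hj1 hjK hjm a => hb K j hj1 hjK hjm a⟩
  rw [← hFL]
  have h1 : ((F.L : ℝ)⁻¹) ^ 4 * (F.L : ℝ) ^ 3 = (F.L : ℝ)⁻¹ := by
    field_simp
  rw [h1]
  exact inv_lt_one_of_one_lt₀ (by linarith)

end Summit.QuantumFields.YangMills.Theorems.UnitScaleTiltHistoryTailOfWeakHeightTail

end
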